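import Literature.NumberTheory.Transcendental.RoySmallValueMainLevel
import Literature.NumberTheory.Transcendental.RoySmallValueStep4Orbit
import Literature.NumberTheory.Transcendental.RoySmallValueStep3Level
import Literature.NumberTheory.Transcendental.RoySmallValueOrbitChart
import Literature.NumberTheory.Transcendental.RoySmallValueMainPrelims
import Literature.NumberTheory.Transcendental.RoySmallValueGammaBound
import Literature.NumberTheory.Transcendental.RoySmallValueWindows
import Literature.NumberTheory.Transcendental.RoySmallValueEndgame
import Literature.NumberTheory.Transcendental.RoySmallValueEstimates
import HarnessLib

/-!
# Roy's small value estimate for `𝔾ₐ × 𝔾ₘ` — proof of Theorem 1.1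

Topic `Literature/NumberTheory/Transcendental`. The discharge `roy2013_thm_1_1_holds` of the named
fact `roy2013_thm_1_1` (`RoySmallValueEstimates.lean`). Source: D. Roy, *A small value estimate for
`𝔾ₐ × 𝔾ₘ`*, Mathematika 59 (2013) 333–363 = arXiv:1301.0663, §7 (pp. 18–19):

> We shall argue by contradiction, assuming on the contrary that `(1:γ)` is not a point of
> `ℙ²(ℚ̄)`. [...] Step 1. [...] Step 2. [...] Step 3. Denote by `D*` the smallest positive integer
> for which `Z ⊆ 𝒵(𝒟ⁱP̃_{D*+1} ; 0 ≤ i < 2⌊(D*+1)^τ⌋)` [...] Step 4. [...] Step 5. [...] This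
> contradicts the hypothesis on `ν`, and therefore proves that `ξ, η ∈ ℚ̄`.

The assembly follows the printed proof step by step, in the language of this development (the
determinant `Φ` of Theorem 5.2 instead of the resultant, Galois orbits of normalised common zeros
instead of `ℚ`-subvarieties, Mathlib's Weil height): parameters `T = ⌊D^τ⌋`, `Y = 3D^β`,
`U = D^ν/4`; Step 1 = `mem_body_of_step1`; Step 2 = `LevelPkg.step2_level` (orbit `O`, vanishing
of the `𝒟ʲP̃_D` on `O`, distance sum) with the thresholds of `RoySmallValueThresholds` /
`RoySmallValueGammaBound`; the point `α₀` = `exists_close_point_of_sum_le`; Step 3 = `Nat.find` for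
`D*`, `D* → ∞` by `exists_pdist_lower_bound` at the level `D₁ + 1`, the bounds by
`ZeroConfigK.step3_bounds` at the level `D* + 1` (chart from `ZeroConfigK.chart_of_mem_orb`);
Steps 4–5 = `ZeroConfigK.step45_combined` (`RoySmallValueStep4Orbit`); conclusion = `endgame`
(`RoySmallValueEndgame`, parallel seat). Everything is
proved; no definitions, no named facts. The fact's discharge under its own fully qualified name,
`Literature.NumberTheory.Transcendental.roy2013_thm_1_1_holds`, is the final alias of this file.

## References

* [Roy2013] D. Roy, *A small value estimate for 𝔾ₐ × 𝔾ₘ*, Mathematika 59 (2013), 333–363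
  (arXiv:1301.0663), Theorem 1.1 and §7.
-/

noncomputable section

open MvPolynomial Finset Height Filter

namespace Literature.NumberTheory.Transcendental

namespace Roy2013

open Nesterenko

/-- `exp(−κ n^e) < c` eventually (`κ, e, c > 0`). [folklore] -/
theorem eventually_exp_neg_lt {κ e c : ℝ} (hκ : 0 < κ) (he : 0 < e) (hc : 0 < c) :
    ∀ᶠ n : ℕ in atTop, Real.exp (-(κ * (n : ℝ) ^ e)) < c := by
  have ht : Tendsto (fun n : ℕ => κ * (n : ℝ) ^ e) atTop atTop :=
    (tendsto_rpow_atTop he).comp tendsto_natCast_atTop_atTop |>.const_mul_atTop hκ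
  filter_upwards [ht.eventually_gt_atTop (-Real.log c)] with n hn
  calc Real.exp (-(κ * (n : ℝ) ^ e)) < Real.exp (Real.log c) := Real.exp_lt_exp.mpr (by linarith)
    _ = c := Real.exp_log hc

/-- `1/log(3/2) ≤ 3`. [folklore] -/
theorem inv_log_three_halves_le : (Real.log (3 / 2))⁻¹ ≤ 3 := by
  have h := Real.one_sub_inv_le_log_of_pos (show (0 : ℝ) < 3 / 2 by norm_num)
  have h3 : (1 : ℝ) / 3 ≤ Real.log (3 / 2) := by norm_num at h ⊢; linarith
  rw [inv_le_comm₀ (by linarith) (by norm_num)]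
  linarith

set_option maxHeartbeats 400000 in
/-- **Roy 2013, Theorem 1.1.** [cite: Roy2013, Theorem 1.1 and §7] -/
theorem roy2013_thm_1_1_holds : roy2013_thm_1_1 := by
  intro ξ η hη β τ ν hτ1 hτ2 hτβ hν hseq
  by_contra hna
  classical
  /- ───── exponents ───── -/
  have hβ1 : 1 < β := lt_of_le_of_lt hτ1 hτβ
  have hβ0 : 0 < β := by linarith
  have hτ0 : 0 < τ := by linarith
  have hβτ : 0 < β + 1 - τ := by linarith
  have hfrac0 : 0 ≤ (τ - 1) * (2 - τ) / (β + 1 - τ) :=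
    div_nonneg (mul_nonneg (by linarith) (by linarith)) hβτ.le
  obtain ⟨δ, hδdef⟩ : ∃ δ : ℝ, δ = ν + τ - 2 - β := ⟨_, rfl⟩
  have hδfrac : (τ - 1) * (2 - τ) / (β + 1 - τ) < δ := by rw [hδdef]; linarith
  have hδ0 : 0 < δ := lt_of_le_of_lt hfrac0 hδfrac
  have hν2 : 2 < ν := by linarith
  have hν1 : 1 < ν := by linarith
  have hτν : τ < ν := by linarith
  have h2β : 2 + β < τ + ν := by linarith
  have h3 : 3 < τ + ν := by linarith
  have hν' : 2 + β - τ < ν := by linarith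
  /- ───── constants ───── -/
  have hc2 : 1 ≤ roy_c2 ξ η := one_le_roy_c2 ξ η
  have hc4 : 0 < roy_c4 ξ η := roy_c4_pos ξ η
  have hcI : (1 : ℝ) ≤ 3 * (1 + ‖ξ‖ + ‖η‖⁻¹) := by
    have : 0 ≤ ‖ξ‖ := norm_nonneg _; have : 0 ≤ ‖η‖⁻¹ := inv_nonneg.mpr (norm_nonneg _); linarith
  have hM1 : (1 : ℝ) ≤ max 1 ‖ξ‖ * max 1 ‖η‖⁻¹ :=
    one_le_mul_of_one_le_of_one_le (le_max_left _ _) (le_max_left _ _)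
  obtain ⟨A₃, hA₃⟩ : ∃ A₃ : ℝ, A₃ = 74 * (2 : ℝ) ^ (1 + β - τ) := ⟨_, rfl⟩
  have hA₃0 : 0 < A₃ := by rw [hA₃]; positivity
  obtain ⟨κ, hκ⟩ : ∃ κ : ℝ, κ = 1 / 1280 := ⟨_, rfl⟩
  have hκ0 : 0 < κ := by rw [hκ]; norm_num
  /- ───── the sequence ───── -/
  obtain ⟨D₀, hD₀⟩ := eventually_atTop.mp hseq
  choose! P hP0 hPdeg hPht hPval using hD₀
  /- ───── thresholds ───── -/
  have hev := ((((((((((((((eventually_ge_atTop (max D₀ 5)).and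
    (eventually_36_mul_natFloor_le_sq hτ2)).and (eventually_natFloor_le_choose hτ2)).and
    eventually_sq_lt_two_pow).and (eventually_step1_norm hτβ hβ0)).and
    (eventually_step1_value hτν hν1 hM1)).and (eventually_levelQ_norm hβ1)).and
    (eventually_levelQ_value hν1)).and (eventually_interp_const hτ0 hτβ hcI)).and
    (eventually_log_eps hτ0.le h2β h3)).and (eventually_N_log_N hβ0)).and
    (eventually_gamma_le_rpow ξ η hτ0 hτβ)).and
    (eventually_step4_big (c := Real.log 2 + 2 * roy_c2 ξ η ^ 2) (A₃ := A₃) hτ1 hν' hτβ)).and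
    (eventually_step4_const (c := Real.log (roy_c4 ξ η)) hβ1)).and
    (eventually_exp_neg_lt (e := ν - 2) hκ0 (by linarith only [hν2])
      (show 0 < ‖η‖ / (2 * roy_c2 ξ η ^ 2) by have := norm_pos_iff.mpr hη; positivity))
  obtain ⟨D₁, hD₁⟩ := eventually_atTop.mp hev
  /- ───── the integer parameters `T n = ⌊n^τ⌋`, and facts for `n ≥ D₁` ───── -/
  obtain ⟨Tn, hTn⟩ : ∃ Tn : ℕ → ℕ, Tn = fun n : ℕ => ⌊((n : ℕ) : ℝ) ^ τ⌋₊ := ⟨_, rfl⟩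
  have hTn' : ∀ n : ℕ, ⌊((n : ℕ) : ℝ) ^ τ⌋₊ = Tn n := fun n => by rw [hTn]
  have hD₀le : ∀ n, D₁ ≤ n → D₀ ≤ n := fun n hn =>
    le_trans (le_max_left _ _) (hD₁ n hn).1.1.1.1.1.1.1.1.1.1.1.1.1.1
  have h5le : ∀ n, D₁ ≤ n → 5 ≤ n := fun n hn =>
    le_trans (le_max_right _ _) (hD₁ n hn).1.1.1.1.1.1.1.1.1.1.1.1.1.1
  have h1le : ∀ n, D₁ ≤ n → 1 ≤ n := fun n hn => le_trans (by norm_num) (h5le n hn)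
  have hTge : ∀ n, n ≤ Tn n := fun n => by rw [hTn]; exact self_le_natFloor_rpow hτ1 n
  have hT1 : ∀ n, D₁ ≤ n → 1 ≤ Tn n := fun n hn => le_trans (h1le n hn) (hTge n)
  have hTle : ∀ n, (Tn n : ℝ) ≤ (n : ℝ) ^ τ := fun n => by rw [hTn]; exact natFloor_rpow_le n τ
  have hT2 : ∀ n, D₁ ≤ n → (n : ℝ) ^ τ ≤ 2 * Tn n := fun n hn => by
    rw [hTn]; exact rpow_le_two_mul_natFloor (h1le n hn) hτ0.le
  /- the forms `P̃_n` -/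
  obtain ⟨Pt, hPt⟩ : ∃ Pt : ℕ → MvPolynomial (Fin 3) ℤ,
      Pt = fun n => if h : D₀ ≤ n then royTilde n (hP0 n h) else 0 := ⟨_, rfl⟩
  have hPtn : ∀ n (hn : D₁ ≤ n), Pt n = royTilde n (hP0 n (hD₀le n hn)) := fun n hn => by
    rw [hPt]; exact dif_pos (hD₀le n hn)
  have hPth : ∀ n, D₁ ≤ n → (map (Int.castRingHom ℂ) (Pt n)).IsHomogeneous n := fun n hn => by
    rw [hPtn n hn]; exact isHomogeneous_map_royTilde _ (hPdeg n (hD₀le n hn))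
  have hPt0 : ∀ n, D₁ ≤ n → map (Int.castRingHom ℂ) (Pt n) ≠ 0 := fun n hn => by
    rw [hPtn n hn]; exact map_royTilde_ne_zero _
  /- Step 1: the bodies -/
  have hbody : ∀ n (hn : D₁ ≤ n), ∀ j ≤ 2 * Tn n,
      map (Int.castRingHom ℂ) ((homDK ℤ)^[j] (royTilde n (hP0 n (hD₀le n hn)))) ∈
        royBody n ξ η (3 * (n : ℝ) ^ β) ((n : ℝ) ^ ν / 4) (Tn n) ∧
      map (Int.castRingHom ℂ) ((homDK ℤ)^[j] (royTilde n (hP0 n (hD₀le n hn)))) ∈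
        royBody n ξ η (2 * (n : ℝ) ^ β) ((n : ℝ) ^ ν / 2) (Tn n) := by
    intro n hn j hj
    have hE := hD₁ n hn
    have hmem := mem_body_of_step1 (hP0 n (hD₀le n hn)) (hPdeg n (hD₀le n hn)) hη (τ := τ) (β := β)
      (ν := ν) (h1le n hn) j (by rw [hTn'] ; exact hj) (hPht n (hD₀le n hn))
      (fun t ht => hPval n (hD₀le n hn) t (by rw [hTn'] at ht ⊢; omega))
      hE.1.1.1.1.1.1.1.1.1.1.2 hE.1.1.1.1.1.1.1.1.1.2
    rw [hTn'] at hmem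
    refine ⟨royBody_mono ?_ ?_ hmem, hmem⟩
    · have h0 : (0 : ℝ) ≤ (n : ℝ) ^ β := Real.rpow_nonneg (Nat.cast_nonneg n) β
      linarith only [h0]
    · have h0 : (0 : ℝ) ≤ (n : ℝ) ^ ν := Real.rpow_nonneg (Nat.cast_nonneg n) ν
      linarith only [h0]
  have hPmem : ∀ n (hn : D₁ ≤ n), map (Int.castRingHom ℂ) (Pt n) ∈
      royBody n ξ η (3 * (n : ℝ) ^ β) ((n : ℝ) ^ ν / 4) (Tn n) := fun n hn => by
    have := (hbody n hn 0 (Nat.zero_le _)).1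
    rwa [Function.iterate_zero_apply, ← hPtn n hn] at this
  /- the level packages -/
  have hLne : ∀ n, D₁ ≤ n → Nonempty (LevelPkg n (Pt n)) := fun n hn => by
    have h := nonempty_levelPkg (h1le n hn) (hPth n hn) (hPt0 n hn)
      (by rw [hPtn n hn]; exact not_X_zero_dvd_royTilde _ (hPdeg n (hD₀le n hn)))
      (by rw [hPtn n hn]; exact not_X_two_dvd_royTilde _)
    exact h
  obtain ⟨Lf, hLf⟩ : ∃ Lf : ∀ n, D₁ ≤ n → LevelPkg n (Pt n), True :=
    ⟨fun n hn => Classical.choice (hLne n hn), trivial⟩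
  /- the companion forms `Q_n` lie in the body -/
  have hQmem : ∀ n (hn : D₁ ≤ n), map (Int.castRingHom ℂ) (levelQ n (Pt n) (Lf n hn).t) ∈
      royBody n ξ η (3 * (n : ℝ) ^ β) ((n : ℝ) ^ ν / 4) (Tn n) := by
    intro n hn
    have hE := hD₁ n hn
    have ht1 := (Lf n hn).one_le_t
    have htle : (Lf n hn).t ≤ n ^ 2 := (Lf n hn).ht
    have hx1 : (1 : ℝ) ≤ n := by exact_mod_cast h1le n hn
    have htpow : ((Lf n hn).t : ℝ) ^ n ≤ ((n : ℝ) ^ 2) ^ n := by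
      exact pow_le_pow_left₀ (Nat.cast_nonneg _) (by exact_mod_cast htle) n
    refine levelQ_mem_royBody ht1 (Y₀ := 2 * (n : ℝ) ^ β) (U₀ := (n : ℝ) ^ ν / 2) (fun i hi => ?_) ?_ ?_
    · have hi2 : i ≤ 2 * Tn n := by
        have := (mem_Icc.mp hi).2; have := hTge n; omega
      have := (hbody n hn i hi2).2
      rw [map_iterate_homDK, ← hPtn n hn] at this
      exact this
    · refine le_trans ?_ hE.1.1.1.1.1.1.1.1.2
      have h0 : (0 : ℝ) ≤ (n : ℝ) * Real.exp (2 * (n : ℝ) ^ β) := by positivity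
      calc (n : ℝ) * ((Lf n hn).t : ℝ) ^ n * Real.exp (2 * (n : ℝ) ^ β)
          = ((Lf n hn).t : ℝ) ^ n * ((n : ℝ) * Real.exp (2 * (n : ℝ) ^ β)) := by ring
        _ ≤ ((n : ℝ) ^ 2) ^ n * ((n : ℝ) * Real.exp (2 * (n : ℝ) ^ β)) :=
            mul_le_mul_of_nonneg_right htpow h0
        _ = _ := by ring
    · refine le_trans ?_ hE.1.1.1.1.1.1.1.2
      have h0 : (0 : ℝ) ≤ (n : ℝ) * Real.exp (-((n : ℝ) ^ ν / 2)) := by positivity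
      calc (n : ℝ) * ((Lf n hn).t : ℝ) ^ n * Real.exp (-((n : ℝ) ^ ν / 2))
          = ((Lf n hn).t : ℝ) ^ n * ((n : ℝ) * Real.exp (-((n : ℝ) ^ ν / 2))) := by ring
        _ ≤ ((n : ℝ) ^ 2) ^ n * ((n : ℝ) * Real.exp (-((n : ℝ) ^ ν / 2))) :=
            mul_le_mul_of_nonneg_right htpow h0
        _ = _ := by ring
  /- the separation at the level `D₁ + 1` and the final threshold `D₃` -/
  have hD₁s : D₁ ≤ D₁ + 1 := Nat.le_succ _
  obtain ⟨ε₁, hε₁, hsep⟩ := exists_pdist_lower_bound hna (isHomogeneous_map_rat (hPth _ hD₁s))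
    (isHomogeneous_map_rat (isHomogeneous_map_levelQ (hPth _ hD₁s) (Lf _ hD₁s).t))
    (by rw [toCX_map_int]; exact hPt0 _ hD₁s) (by rw [toCX_map_int]; exact (Lf _ hD₁s).hQ0)
    (by rw [toCX_map_int, toCX_map_int]; exact isRelPrime_of_regular (hPt0 _ hD₁s) (Lf _ hD₁s).hPQ)
  obtain ⟨D₃, hD₃⟩ := eventually_atTop.mp (eventually_exp_neg_lt (e := ν - 2) hκ0 (by linarith only [hν2]) hε₁)
  /- ───── the endgame ───── -/
  refine endgame hτ1 hτβ hδ0 hδfrac hκ0 (by norm_num : (0 : ℝ) < 8) hA₃0 fun Nr => ?_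
  -- the level `D`
  obtain ⟨D, hDdef⟩ : ∃ D : ℕ, D = max (⌈Nr⌉₊) (max D₃ (D₁ + 2)) := ⟨_, rfl⟩
  have hDN : Nr ≤ D := by rw [hDdef]; exact le_trans (Nat.le_ceil Nr) (by exact_mod_cast le_max_left _ _)
  have hDD₃ : D₃ ≤ D := by rw [hDdef]; exact le_trans (le_max_left _ _) (le_max_right _ _)
  have hDD₁ : D₁ + 2 ≤ D := by rw [hDdef]; exact le_trans (le_max_right _ _) (le_max_right _ _)
  have hD₁D : D₁ ≤ D := by omega
  have hE := hD₁ D hD₁D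
  have hx : (0 : ℝ) < D := by exact_mod_cast (h1le D hD₁D)
  have hx1 : (1 : ℝ) ≤ D := by exact_mod_cast (h1le D hD₁D)
  have hx5 : (5 : ℝ) ≤ D := by exact_mod_cast (h5le D hD₁D)
  -- abbreviations at level `D`
  obtain ⟨T, hT⟩ : ∃ T : ℕ, T = Tn D := ⟨_, rfl⟩
  obtain ⟨Y, hY⟩ : ∃ Y : ℝ, Y = 3 * (D : ℝ) ^ β := ⟨_, rfl⟩
  obtain ⟨U, hU⟩ : ∃ U : ℝ, U = (D : ℝ) ^ ν / 4 := ⟨_, rfl⟩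
  have hY0 : 0 < Y := by rw [hY]; positivity
  have hU0 : 0 ≤ U := by rw [hU]; positivity
  have hT1' : 1 ≤ T := by rw [hT]; exact hT1 D hD₁D
  have hTD : D ≤ T := by rw [hT]; exact hTge D
  have hTτ : (T : ℝ) ≤ (D : ℝ) ^ τ := by rw [hT]; exact hTle D
  have hTpos : (0 : ℝ) < T := by exact_mod_cast hT1'
  -- the window `Li`, the ratio `kr`, the exponent `k`
  obtain ⟨Li, hLi1, hLi2⟩ := exists_choose_window hT1'
  have h36 : 36 * T ≤ D ^ 2 := by rw [hT, ← hTn']; exact hE.1.1.1.1.1.1.1.1.1.1.1.1.1.2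
  have h3L : 3 * (Li + 1) ≤ D := three_mul_window_succ_le hLi1 h36
  obtain ⟨kr, hkr, hkrle⟩ := exists_ratio_k (h1le D hD₁D) hTD
  have hsq : D ^ 2 < 2 ^ D := hE.1.1.1.1.1.1.1.1.1.1.1.2
  have hkex : ∃ k : ℕ, D ^ 2 ≤ 2 ^ k := ⟨D, hsq.le⟩
  obtain ⟨k, hk⟩ : ∃ k : ℕ, k = Nat.find hkex := ⟨_, rfl⟩
  have hkspec : D ^ 2 ≤ 2 ^ k := by rw [hk]; exact Nat.find_spec hkex
  have hkD : k ≤ D := by rw [hk]; exact Nat.find_min' hkex hsq.le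
  have h2k : 2 ^ k ≤ 2 * D ^ 2 := by
    rcases Nat.eq_zero_or_pos k with hk0 | hkpos
    · rw [hk0, pow_zero]; have h := h1le D hD₁D; nlinarith only [h]
    · have hmin : ¬(D ^ 2 ≤ 2 ^ (k - 1)) := by rw [hk] at hkpos ⊢; exact Nat.find_min hkex (Nat.sub_one_lt_of_lt hkpos)
      push Not at hmin
      have : 2 ^ k = 2 * 2 ^ (k - 1) := by rw [← pow_succ']; congr 1; omega
      omega
  -- the field `K` containing the coordinates of all the packages of levels `D₁ ≤ n ≤ D`
  obtain ⟨S, hS⟩ : ∃ S : Finset ℂ, S = (Finset.Icc D₁ D).attach.biUnion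
      (fun n => (Lf n.1 (mem_Icc.mp n.2).1).coords) := ⟨_, rfl⟩
  have hSalg : ∀ x ∈ S, IsAlgebraic ℚ x := by
    intro x hx
    rw [hS] at hx
    obtain ⟨n, -, hn⟩ := mem_biUnion.mp hx
    exact (Lf n.1 _).isAlgebraic_of_mem_coords hn
  have hKn : ∀ n (hn : D₁ ≤ n) (hnD : n ≤ D), ∀ i kk, (Lf n hn).α i kk ∈ closureField S := by
    intro n hn hnD i kk
    refine mem_closureField hSalg ?_
    rw [hS]
    exact mem_biUnion.mpr ⟨⟨n, mem_Icc.mpr ⟨hn, hnD⟩⟩, mem_attach _ _, (Lf n hn).mem_coords i kk⟩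
  /- ───── Step 2 at the level `D` ───── -/
  obtain ⟨L, hLdef⟩ : ∃ L : LevelPkg D (Pt D), L = Lf D hD₁D := ⟨_, rfl⟩
  have hK : ∀ i kk, L.α i kk ∈ closureField S := by rw [hLdef]; exact hKn D hD₁D le_rfl
  -- the bound `B`
  obtain ⟨B, hB⟩ : ∃ B : ℝ, B = 40 * (D : ℝ) ^ (2 + β) := ⟨_, rfl⟩
  have hB0 : 0 < B := by rw [hB]; positivity
  have hPmemD := hPmem D hD₁D
  have hQmemD := hQmem D hD₁D
  rw [← hLdef, ← hT, ← hY, ← hU] at hQmemD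
  rw [← hT, ← hY, ← hU] at hPmemD
  have hp2b : (D : ℝ) ^ (2 + β) = (D : ℝ) ^ 2 * (D : ℝ) ^ β := by
    rw [Real.rpow_add hx, Real.rpow_two]
  -- opaque names for the three cardinalities (performance: never compute with `Fintype.card ↥(finsuppAntidiag …)`)
  obtain ⟨N, hN⟩ : ∃ N : ℕ, N = Fintype.card (PhiRow D) := ⟨_, rfl⟩
  obtain ⟨N₀, hN₀⟩ : ∃ N₀ : ℕ, N₀ = Fintype.card ↥(finsuppAntidiag (univ : Finset (Fin 3)) (2 * D)) := ⟨_, rfl⟩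
  obtain ⟨N₁, hN₁⟩ : ∃ N₁ : ℕ, N₁ = Fintype.card ↥L.M₁ := ⟨_, rfl⟩
  have hNeq : N = (3 * D + 2).choose 2 := by rw [hN, LevelPkg.card_phiRow]
  have hN₀eq : N₀ = (2 * D + 2).choose 2 := by rw [hN₀, LevelPkg.card_antidiag_two]
  have hN₁le : N₁ ≤ (2 * D + 2).choose 2 := by rw [hN₁]; exact L.card_M₁_le
  have hNr : (N : ℝ) = ((3 * D + 2).choose 2 : ℝ) := by rw [hNeq]
  have hN₀r : (N₀ : ℝ) ≤ 5 * (D : ℝ) ^ 2 := by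
    rw [hN₀eq]; exact choose_two_le (le_trans (by norm_num) (h5le D hD₁D))
  have hN₁r : (N₁ : ℝ) ≤ 5 * (D : ℝ) ^ 2 :=
    le_trans (by exact_mod_cast hN₁le) (choose_two_le (le_trans (by norm_num) (h5le D hD₁D)))
  have hNlog : Real.log (N.factorial : ℝ) ≤ 7 * ((D : ℝ) ^ 2 * (D : ℝ) ^ β) := by
    have hf := LevelPkg.log_factorial_le N
    have hNN := hE.1.1.1.1.2
    rw [hp2b, ← hNr] at hNN
    linarith only [hf, hNN]
  have hBle : Y * D ^ 2 + (∑ i, (L.e i : ℝ) * (D * logHeight ((L.cfg (closureField S) hK).rep i))) /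
      Module.finrank ℚ (closureField S) ≤ B := by
    have h1 := L.sum_e_mul_height_le' (closureField S) hK (MP := Real.exp Y) (MQ := Real.exp Y)
      (Real.one_le_exp hY0.le) (Real.one_le_exp hY0.le) hPmemD.2.1 hQmemD.2.1
    rw [← hN, ← hN₀, ← hN₁, Real.log_exp] at h1
    have hn : (0 : ℝ) < Module.finrank ℚ (closureField S) := by exact_mod_cast Module.finrank_pos
    -- `log N! + (N₀ + N₁) Y ≤ 37 D^{2+β}`
    have hcards : Real.log (N.factorial : ℝ) + N₀ * Y + N₁ * Y ≤ 37 * ((D : ℝ) ^ 2 * (D : ℝ) ^ β) := by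
      rw [hY]
      have hβ' : 0 ≤ (D : ℝ) ^ β := Real.rpow_nonneg hx.le _
      have h3β : (0 : ℝ) ≤ 3 * (D : ℝ) ^ β := by positivity
      have e1 := mul_le_mul_of_nonneg_right hN₀r h3β
      have e2 := mul_le_mul_of_nonneg_right hN₁r h3β
      linarith only [hNlog, e1, e2]
    have h2 : (∑ i, (L.e i : ℝ) * (D * logHeight ((L.cfg (closureField S) hK).rep i))) /
        Module.finrank ℚ (closureField S) ≤ 37 * ((D : ℝ) ^ 2 * (D : ℝ) ^ β) := by
      rw [div_le_iff₀ hn]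
      calc (∑ i, (L.e i : ℝ) * (D * logHeight ((L.cfg (closureField S) hK).rep i)))
          ≤ _ := h1
        _ ≤ Module.finrank ℚ (closureField S) * (37 * ((D : ℝ) ^ 2 * (D : ℝ) ^ β)) :=
            mul_le_mul_of_nonneg_left hcards hn.le
        _ = 37 * ((D : ℝ) ^ 2 * (D : ℝ) ^ β) * Module.finrank ℚ (closureField S) := by ring
    rw [hB, hp2b]
    have h3 : Y * (D : ℝ) ^ 2 = 3 * ((D : ℝ) ^ 2 * (D : ℝ) ^ β) := by rw [hY]; ring
    linarith only [h2, h3]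
  -- `ε < 1`, and `log ε ≤ −TU/2`
  obtain ⟨ε, hεdef⟩ : ∃ ε : ℝ, ε = 2 ^ (2 * k * 2 ^ k) * (Real.exp (-(T * U)) *
      ((Fintype.card (PhiRow D)).factorial * (3 * Real.exp Y) ^ Fintype.card (PhiRow D))) *
        Real.exp (Y * D ^ 2) := ⟨_, rfl⟩
  have hεN : ε = 2 ^ (2 * k * 2 ^ k) * (Real.exp (-(T * U)) * (N.factorial * (3 * Real.exp Y) ^ N)) *
      Real.exp (Y * D ^ 2) := by rw [hεdef, ← hN]
  have hε0 : 0 < ε := by rw [hεN]; positivity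
  have hlogε : Real.log ε ≤ -(T * U) / 2 := by
    have hfpos : (0 : ℝ) < N.factorial := by exact_mod_cast Nat.factorial_pos N
    rw [hεN, Real.log_mul (by positivity) (by positivity), Real.log_mul (by positivity) (by positivity),
      Real.log_mul (by positivity) (by positivity), Real.log_mul (by positivity) (by positivity),
      Real.log_pow, Real.log_pow, Real.log_exp, Real.log_exp, Real.log_mul (by norm_num) (by positivity),
      Real.log_exp]
    have hle := hE.1.1.1.1.1.2
    rw [hTn', ← hT, ← hNr] at hle
    have hf := LevelPkg.log_factorial_le N
    have hkk : ((2 * k * 2 ^ k : ℕ) : ℝ) ≤ 4 * (D : ℝ) ^ 3 := by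
      have : 2 * k * 2 ^ k ≤ 4 * D ^ 3 := by
        calc 2 * k * 2 ^ k ≤ 2 * D * (2 * D ^ 2) := Nat.mul_le_mul (Nat.mul_le_mul_left 2 hkD) h2k
          _ = 4 * D ^ 3 := by ring
      exact_mod_cast this
    have hl2 : 0 ≤ Real.log 2 := Real.log_nonneg (by norm_num)
    have hNpos : (0 : ℝ) ≤ N := Nat.cast_nonneg _
    rw [hY, hU]
    have e1 := mul_le_mul_of_nonneg_right hkk hl2
    linarith only [e1, hle, hf]
  have hε1 : ε < 1 := by
    have hlt : Real.log ε < 0 := by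
      have hTU0 : 0 < (T : ℝ) * U := by rw [hU]; positivity
      linarith only [hlogε, hTU0]
    exact (Real.log_neg_iff hε0).mp hlt
  -- the interpolation constant
  have hYI : (3 * (1 + ‖ξ‖ + ‖η‖⁻¹)) ^ Li * (4 * (Li + 1) : ℝ) ^ (Li + 2).choose 2 ≤ Real.exp Y := by
    have hI := hE.1.1.1.1.1.1.2
    rw [hTn', ← hT] at hI
    have hLiT : Li ≤ T := window_le hLi1
    have hch : (Li + 2).choose 2 ≤ 3 * T := choose_window_le hLi1
    have hI' : (3 * (1 + ‖ξ‖ + ‖η‖⁻¹)) ^ T * (4 * ((T : ℝ) + 1)) ^ (3 * T) ≤ Real.exp Y := by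
      rw [hY]; exact hI
    refine le_trans ?_ hI'
    have h1 : (3 * (1 + ‖ξ‖ + ‖η‖⁻¹)) ^ Li ≤ (3 * (1 + ‖ξ‖ + ‖η‖⁻¹)) ^ T := pow_le_pow_right₀ hcI hLiT
    have hb1 : (1 : ℝ) ≤ 4 * ((Li : ℝ) + 1) := by have h0 : (0:ℝ) ≤ Li := Nat.cast_nonneg _; linarith only [h0]
    have h2 : (4 * ((Li : ℝ) + 1)) ^ (Li + 2).choose 2 ≤ (4 * ((T : ℝ) + 1)) ^ (3 * T) :=
      (pow_le_pow_right₀ hb1 hch).trans (pow_le_pow_left₀ (by positivity) (by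
        have hLr : (Li : ℝ) ≤ T := by exact_mod_cast hLiT
        linarith only [hLr]) _)
    exact mul_le_mul h1 h2 (by positivity) (by positivity)
  -- Step 2
  obtain ⟨j₀, hvanO, hdistO⟩ := L.step2_level (hPth D hD₁D) (hPt0 D hD₁D) hη hna hLi1 hLi2 h3L hTD hkr
    hY0 hU0 hYI hPmemD hQmemD hkspec (closureField S) hK hB0 hBle (by rw [← hεdef]; exact hε1)
  rw [← hεdef] at hdistO
  obtain ⟨Z, hZdef⟩ : ∃ Z : ZeroConfigK (closureField S) (Fin L.m), Z = L.cfg (closureField S) hK := ⟨_, rfl⟩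
  obtain ⟨O, hOdef⟩ : ∃ O : Finset (Fin L.m), O = (L.cfg (closureField S) hK).orb j₀ := ⟨_, rfl⟩
  obtain ⟨hO, hhO⟩ : ∃ hO : ℝ, hO = (∑ j ∈ O, logHeight ((L.cfg (closureField S) hK).rep j)) /
      Module.finrank ℚ (closureField S) := ⟨_, rfl⟩
  have hn0 : (0 : ℝ) < Module.finrank ℚ (closureField S) := by exact_mod_cast Module.finrank_pos
  have hhO0 : 0 ≤ hO := by
    rw [hhO]; exact div_nonneg (sum_nonneg fun j _ => logHeight_nonneg _) hn0.le
  obtain ⟨d, hd⟩ : ∃ d : ℝ, d = O.card := ⟨_, rfl⟩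
  have hOne : O.Nonempty := by rw [hOdef]; exact ⟨j₀, (L.cfg (closureField S) hK).self_mem_orb j₀⟩
  have hd1 : 1 ≤ d := by rw [hd]; exact_mod_cast hOne.card_pos
  -- the distance sum: `≤ −Λ₂`, `Λ₂ = κ D^δ (D^β d + D hO)`
  obtain ⟨Λ₂, hΛ₂⟩ : ∃ Λ₂ : ℝ, Λ₂ = κ * (D : ℝ) ^ δ * ((D : ℝ) ^ β * d + D * hO) := ⟨_, rfl⟩
  have hdist2 : ∑ j ∈ O.filter (fun j => pdist ξ η (supNormalise (L.α j)) ≤ (2 * roy_c2 ξ η)⁻¹),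
      max (T * Real.log (pdist ξ η (supNormalise (L.α j))))
        (if 0 < adist ξ η (supNormalise (L.α j)) then Real.log (adist ξ η (supNormalise (L.α j)))
          else T * Real.log (pdist ξ η (supNormalise (L.α j)))) ≤ -Λ₂ := by
    rw [hOdef]
    refine hdistO.trans ?_
    -- abbreviations inside
    rw [← hOdef]
    -- `Γ'' ≤ D^β ≤ Y/3`
    have hkr3 : (kr : ℝ) ≤ 1 + 3 * Real.log D := by
      refine hkrle.trans ?_
      have hlog : Real.log ((T : ℝ) / D) ≤ Real.log D := by
        have h1 : (T : ℝ) / D ≤ (D : ℝ) ^ τ / D := div_le_div_of_nonneg_right hTτ hx.le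
        have h2 : (D : ℝ) ^ τ / D = (D : ℝ) ^ (τ - 1) := by
          rw [Real.rpow_sub hx, Real.rpow_one]
        have h3 : (D : ℝ) ^ (τ - 1) ≤ (D : ℝ) ^ (1 : ℝ) := Real.rpow_le_rpow_of_exponent_le hx1 (by linarith only [hτ2])
        rw [Real.rpow_one] at h3
        calc Real.log ((T : ℝ) / D) ≤ Real.log ((D : ℝ) ^ (τ - 1)) :=
              Real.log_le_log (div_pos hTpos hx) (by rw [← h2]; exact h1)
          _ ≤ Real.log D := Real.log_le_log (Real.rpow_pos_of_pos hx _) h3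
      have hlog0 : 0 ≤ Real.log D := Real.log_nonneg hx1
      have hl32 : 0 < Real.log (3 / 2) := Real.log_pos (by norm_num)
      have h4 : Real.log ((T : ℝ) / D) / Real.log (3 / 2) ≤ Real.log D / Real.log (3 / 2) :=
        div_le_div_of_nonneg_right hlog hl32.le
      have h5 : Real.log D / Real.log (3 / 2) ≤ Real.log D * 3 := by
        rw [div_eq_mul_inv]; exact mul_le_mul_of_nonneg_left inv_log_three_halves_le hlog0
      linarith only [h4, h5]
    have hΓle := hE.1.1.1.2 T kr hT1' hTτ hkr3
    -- `(w/B) log ε ≤ (w/B)(−TU/2)` and `TU/2 ≥ D^{τ+ν}/16`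
    have hTU : (D : ℝ) ^ τ * (D : ℝ) ^ ν / 16 ≤ T * U / 2 := by
      rw [hU]; have h := hT2 D hD₁D; rw [← hT] at h
      have hν0 := Real.rpow_nonneg hx.le ν
      calc (D : ℝ) ^ τ * (D : ℝ) ^ ν / 16 ≤ (2 * T) * (D : ℝ) ^ ν / 16 :=
            div_le_div_of_nonneg_right (mul_le_mul_of_nonneg_right h hν0) (by norm_num)
        _ = T * ((D : ℝ) ^ ν / 4) / 2 := by ring
    have hδpow : (D : ℝ) ^ δ * (D : ℝ) ^ (2 + β) = (D : ℝ) ^ τ * (D : ℝ) ^ ν := by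
      rw [← Real.rpow_add hx, ← Real.rpow_add hx]; congr 1; rw [hδdef]; ring
    have hwB : ∀ w : ℝ, 0 ≤ w → w / B * Real.log ε ≤ -(w * (D : ℝ) ^ δ / 1280) := by
      intro w hw
      have h1 : w / B * Real.log ε ≤ w / B * (-(T * U) / 2) := mul_le_mul_of_nonneg_left hlogε (div_nonneg hw hB0.le)
      refine h1.trans ?_
      rw [hB]
      have hp : 0 < (D : ℝ) ^ (2 + β) := Real.rpow_pos_of_pos hx _
      rw [div_mul_eq_mul_div, div_le_iff₀ (by positivity)]
      have hTU0 : 0 ≤ w * (T * U / 2) := mul_nonneg hw (by positivity)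
      have e := mul_le_mul_of_nonneg_left hTU hw
      have h2 : w * ((D : ℝ) ^ δ * (D : ℝ) ^ (2 + β)) / 32 ≤ w * (T * U / 2) := by
        rw [hδpow]; linarith only [e, hTU0]
      linarith only [h2]
    -- rename `#O ↦ d`, `Σ h / n ↦ hO`
    rw [← hd]
    have hw_eq : Y * d + (D : ℝ) * (∑ j ∈ O, logHeight ((L.cfg (closureField S) hK).rep j)) /
        (Module.finrank ℚ (closureField S) : ℝ) = Y * d + D * hO := by rw [hhO, mul_div_assoc]
    rw [hw_eq]
    have hw0' : 0 ≤ Y * d + D * hO := by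
      have := hd1; positivity
    have hwO := hwB _ hw0'
    have hd0 : (0 : ℝ) ≤ d := by linarith only [hd1]
    have hβ0' : (0 : ℝ) ≤ (D : ℝ) ^ β := Real.rpow_nonneg hx.le β
    have hδ0' : (0 : ℝ) ≤ (D : ℝ) ^ δ := Real.rpow_nonneg hx.le δ
    have hΓO := mul_le_mul_of_nonneg_right hΓle hd0
    have hwge : (D : ℝ) ^ β * d + D * hO ≤ Y * d + D * hO := by
      rw [hY]; have := mul_nonneg hβ0' hd0; linarith only [this]
    have hprod := mul_le_mul_of_nonneg_right hwge (by positivity : (0 : ℝ) ≤ (D : ℝ) ^ δ / 1280)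
    have hYd : (D : ℝ) ^ β * d ≤ Y * d := by
      rw [hY]; have := mul_nonneg hβ0' hd0; linarith only [this]
    have hβd0 : 0 ≤ (D : ℝ) ^ β * d := mul_nonneg hβ0' hd0
    rw [hΛ₂, hκ]
    linarith only [hwO, hΓO, hprod, hYd, hβd0, hw0']
  have hΛ₂ge : κ * (D : ℝ) ^ (δ + β) * d ≤ Λ₂ := by
    rw [hΛ₂, Real.rpow_add hx]
    have e : 0 ≤ κ * (D : ℝ) ^ δ * (D * hO) :=
      mul_nonneg (mul_nonneg hκ0.le (Real.rpow_nonneg hx.le δ)) (mul_nonneg hx.le hhO0)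
    linarith only [e]
  -- the point `α₀ = u_{j₁}` close to `(1:γ)`
  have hMpos : 0 < κ * (D : ℝ) ^ (δ + β) := mul_pos hκ0 (Real.rpow_pos_of_pos hx _)
  have hsumU : ∑ j ∈ O.filter (fun j => pdist ξ η (supNormalise (L.α j)) ≤ (2 * roy_c2 ξ η)⁻¹),
      max (T * Real.log (pdist ξ η (supNormalise (L.α j))))
        (if 0 < adist ξ η (supNormalise (L.α j)) then Real.log (adist ξ η (supNormalise (L.α j)))
          else T * Real.log (pdist ξ η (supNormalise (L.α j)))) ≤ -(κ * (D : ℝ) ^ (δ + β) * d) :=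
    hdist2.trans (by linarith only [hΛ₂ge])
  obtain ⟨j₁, hj₁O, hj₁near, hj₁le⟩ := exists_close_point_of_sum_le O
    (fun j => pdist ξ η (supNormalise (L.α j)) ≤ (2 * roy_c2 ξ η)⁻¹)
    (fun j => (T : ℝ) * Real.log (pdist ξ η (supNormalise (L.α j))))
    (fun j => if 0 < adist ξ η (supNormalise (L.α j)) then Real.log (adist ξ η (supNormalise (L.α j)))
      else T * Real.log (pdist ξ η (supNormalise (L.α j))))
    hMpos (by linarith only [hd1]) (by rw [hd]) hsumU
  have hd₁pos : ∀ j, 0 < pdist ξ η (supNormalise (L.α j)) := fun j =>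
    L.pdist_supNormalise_pos (hPth D hD₁D) (hPt0 D hD₁D) hna j
  have hsmall : pdist ξ η (supNormalise (L.α j₁)) ≤ Real.exp (-(κ * (D : ℝ) ^ (ν - 2))) := by
    have h1 : (T : ℝ) * Real.log (pdist ξ η (supNormalise (L.α j₁))) ≤ -(κ * (D : ℝ) ^ (δ + β)) := hj₁le
    have h2 : Real.log (pdist ξ η (supNormalise (L.α j₁))) ≤ -(κ * (D : ℝ) ^ (ν - 2)) := by
      rw [← le_div_iff₀' hTpos] at h1
      refine h1.trans ?_
      have hνsplit : (D : ℝ) ^ (δ + β) = (D : ℝ) ^ (ν - 2) * (D : ℝ) ^ τ := by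
        rw [← Real.rpow_add hx]; congr 1; rw [hδdef]; ring
      rw [hνsplit, neg_div, neg_le_neg_iff, le_div_iff₀ hTpos]
      have h0 := Real.rpow_nonneg hx.le (ν - 2)
      have e := mul_le_mul_of_nonneg_left hTτ (mul_nonneg hκ0.le h0)
      linarith only [e]
    exact (Real.log_le_iff_le_exp (hd₁pos j₁)).mp h2
  have hnear2 : pdist ξ η (supNormalise (L.α j₁)) < ‖η‖ / (2 * roy_c2 ξ η ^ 2) := lt_of_le_of_lt hsmall hE.2
  have hsmallε : pdist ξ η (supNormalise (L.α j₁)) < ε₁ := lt_of_le_of_lt hsmall (hD₃ D hDD₃)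
  -- the chart
  have hchart : ∀ j ∈ O, L.α j 0 ≠ 0 ∧ L.α j 2 ≠ 0 := by
    rw [hOdef] at hj₁O ⊢
    exact (L.cfg (closureField S) hK).chart_of_mem_orb hη hj₁O hj₁near hnear2
  /- ───── Step 3: the level `D*` ───── -/
  -- containment predicate
  have hCex : ∃ n : ℕ, D₁ ≤ n ∧ n + 1 ≤ D ∧ ∀ (hn : D₁ ≤ n + 1), ∀ j ∈ O, ∀ i < 2 * Tn (n + 1),
      eval (L.α j) (homD^[i] (map (Int.castRingHom ℂ) (Pt (n + 1)))) = 0 := by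
    refine ⟨D - 1, by omega, by omega, fun hn j hj i hi => ?_⟩
    have hD1 : D - 1 + 1 = D := by omega
    rw [hD1] at hi ⊢
    have hmem := (hbody D hD₁D i hi.le).1
    rw [hT, hY, hU] at hvanO
    have h := hvanO ((homDK ℤ)^[i] (royTilde D (hP0 D (hD₀le D hD₁D))))
      (isHomogeneous_iterate_homDK_royTilde _ (hPdeg D (hD₀le D hD₁D)) i) hmem j
      (by rw [← hOdef]; exact hj)
    rw [map_iterate_homDK, ← hPtn D hD₁D] at h
    exact h
  obtain ⟨Ds, hDs⟩ : ∃ Ds : ℕ, Ds = Nat.find hCex := ⟨_, rfl⟩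
  obtain ⟨hDs₁, hDsD, hCDs⟩ : D₁ ≤ Ds ∧ Ds + 1 ≤ D ∧ ∀ (hn : D₁ ≤ Ds + 1), ∀ j ∈ O, ∀ i < 2 * Tn (Ds + 1),
      eval (L.α j) (homD^[i] (map (Int.castRingHom ℂ) (Pt (Ds + 1)))) = 0 := by
    rw [hDs]; exact Nat.find_spec hCex
  -- `D* > D₁` (separation at the level `D₁ + 1`)
  have hDsgt : D₁ < Ds := by
    by_contra hle
    have heq : Ds = D₁ := le_antisymm (not_lt.mp hle) hDs₁
    have hvan := hCDs (by omega)
    rw [heq] at hvan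
    -- the point `u_{j₁}` is a sup-normalised common zero of `P̃_{D₁+1}, Q_{D₁+1}`
    have hT2' : 2 ≤ 2 * Tn (D₁ + 1) := by have := hT1 (D₁ + 1) hD₁s; omega
    have hPz : eval (L.α j₁) (map (Int.castRingHom ℂ) (Pt (D₁ + 1))) = 0 := by
      have := hvan j₁ hj₁O 0 (by omega); simpa using this
    have hQz : eval (L.α j₁) (map (Int.castRingHom ℂ) (levelQ (D₁ + 1) (Pt (D₁ + 1)) (Lf _ hD₁s).t)) = 0 := by
      rw [map_levelQ, map_sum]
      refine Finset.sum_eq_zero fun i hi => ?_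
      have hi' : i < 2 * Tn (D₁ + 1) := by
        have := (mem_Icc.mp hi).2; have := hTge (D₁ + 1); omega
      rw [smul_eq_C_mul, map_mul, show (eval (L.α j₁)) (homD^[i] (map (Int.castRingHom ℂ) (Pt (D₁ + 1)))) = 0
        from hvan j₁ hj₁O i hi', mul_zero]
    have hscale : ∀ (F : CX) (m : ℕ), F.IsHomogeneous m → eval (L.α j₁) F = 0 →
        eval (supNormalise (L.α j₁)) F = 0 := by
      intro F m hF hz
      rw [show (eval (supNormalise (L.α j₁)) F : ℂ) = aeval (supNormalise (L.α j₁)) F from rfl, supNormalise,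
        aeval_smul_of_isHomogeneous hF, show (aeval (L.α j₁) F : ℂ) = eval (L.α j₁) F from rfl, hz, mul_zero]
    have h := hsep _ (norm_supNormalise (L.α_ne_zero j₁))
      (by rw [toCX_map_int]; exact hscale _ _ (hPth _ hD₁s) hPz)
      (by rw [toCX_map_int]; exact hscale _ _ (isHomogeneous_map_levelQ (hPth _ hD₁s) _) hQz)
    linarith only [h, hsmallε]
  -- non-containment at the level `D*`
  have hDs1 : 1 ≤ Ds := by have := h1le Ds hDs₁; omega
  have hnc : ∃ j ∈ O, ∃ i < 2 * Tn Ds, eval (L.α j) (homD^[i] (map (Int.castRingHom ℂ) (Pt Ds))) ≠ 0 := by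
    have hmin : ¬(D₁ ≤ Ds - 1 ∧ Ds - 1 + 1 ≤ D ∧ ∀ (hn : D₁ ≤ Ds - 1 + 1), ∀ j ∈ O, ∀ i < 2 * Tn (Ds - 1 + 1),
        eval (L.α j) (homD^[i] (map (Int.castRingHom ℂ) (Pt (Ds - 1 + 1)))) = 0) := by
      rw [hDs]; exact Nat.find_min hCex (by rw [← hDs]; omega)
    have hDs' : Ds - 1 + 1 = Ds := by omega
    rw [hDs'] at hmin
    push Not at hmin
    obtain ⟨-, j, hj, i, hi, hne⟩ := hmin (by omega) (by omega)
    exact ⟨j, hj, i, hi, hne⟩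
  obtain ⟨jn, hjn, i₀, hi₀, hne⟩ := hnc
  -- the form `R = 𝒟^{i₀}P̃_{D*}`
  have hDs₁' : D₁ ≤ Ds := hDs₁
  obtain ⟨R, hRdef⟩ : ∃ R : MvPolynomial (Fin 3) ℤ, R = (homDK ℤ)^[i₀] (royTilde Ds (hP0 Ds (hD₀le Ds hDs₁'))) := ⟨_, rfl⟩
  have hRh : R.IsHomogeneous Ds := by rw [hRdef]; exact isHomogeneous_iterate_homDK_royTilde _ (hPdeg Ds (hD₀le Ds hDs₁')) i₀
  have hRmem : map (Int.castRingHom ℂ) R ∈ royBody Ds ξ η (3 * (Ds : ℝ) ^ β) ((Ds : ℝ) ^ ν / 4) (Tn Ds) := by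
    rw [hRdef]; exact (hbody Ds hDs₁' i₀ hi₀.le).1
  have hRmap : map (Int.castRingHom ℂ) R = homD^[i₀] (map (Int.castRingHom ℂ) (Pt Ds)) := by
    rw [hRdef, map_iterate_homDK, ← hPtn Ds hDs₁']
  have hRne : ∃ j ∈ (L.cfg (closureField S) hK).orb j₀, aeval ((L.cfg (closureField S) hK).α j) (map (Int.castRingHom ℂ) R) ≠ 0 := by
    refine ⟨jn, by rw [← hOdef]; exact hjn, ?_⟩
    rw [hRmap]; exact hne
  -- Step 3 bounds at the level `D' = D* + 1`
  obtain ⟨D', hD'⟩ : ∃ D' : ℕ, D' = Ds + 1 := ⟨_, rfl⟩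
  have hD'₁ : D₁ ≤ D' := by omega
  have hD'D : D' ≤ D := by omega
  have hE' := hD₁ D' hD'₁
  obtain ⟨L', hL'def⟩ : ∃ L' : LevelPkg D' (Pt D'), L' = Lf D' hD'₁ := ⟨_, rfl⟩
  have hK' : ∀ i kk, L'.α i kk ∈ closureField S := by rw [hL'def]; exact hKn D' hD'₁ hD'D
  obtain ⟨Li', hLi'1, hLi'2⟩ := exists_choose_window (hT1 D' hD'₁)
  have hLD' : Li' < D' := window_lt hLi'1 (by rw [← hTn']; exact hE'.1.1.1.1.1.1.1.1.1.1.1.1.2)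
  have hvan' : ∀ j ∈ (L.cfg (closureField S) hK).orb j₀, ∀ kk < Tn D' + D',
      eval ((L.cfg (closureField S) hK).α j) (homD^[kk] (map (Int.castRingHom ℂ) (Pt D'))) = 0 := by
    intro j hj kk hkk
    rw [hD'] at hkk ⊢
    exact hCDs (by omega) j (by rw [hOdef]; exact hj) kk (by have := hTge (Ds + 1); omega)
  obtain ⟨hdeg3, hht3⟩ := (L.cfg (closureField S) hK).step3_bounds j₀ L' (hPth D' hD'₁) hK' hLi'1 hLi'2 hLD'
    (fun j hj => (hchart j (by rw [hOdef]; exact hj)).1) (fun j hj => (hchart j (by rw [hOdef]; exact hj)).2) hvan'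
  rw [← hOdef] at hdeg3 hht3
  -- `hO ≤ A₃ Ds^{1+β−τ}` and `d ≤ 8 Ds^{2−τ}`
  have hxs : (0 : ℝ) < Ds := by exact_mod_cast hDs1
  have hxs1 : (1 : ℝ) ≤ Ds := by exact_mod_cast hDs1
  have hx' : (0 : ℝ) < D' := by rw [hD']; push_cast; linarith only [hxs]
  have hD'2 : (D' : ℝ) ≤ 2 * Ds := by rw [hD']; push_cast; linarith only [hxs1]
  have hT'pos : (0 : ℝ) < Tn D' := by exact_mod_cast hT1 D' hD'₁
  have hT'ge : (D' : ℝ) ^ τ ≤ 2 * Tn D' := hT2 D' hD'₁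
  have hlogL' : Real.log (∑ m ∈ L'.intF.support, |((coeff m L'.intF : ℤ) : ℝ)|) ≤ 37 * (D' : ℝ) ^ (2 + β) := by
    have hPm := hPmem D' hD'₁
    have hQm := hQmem D' hD'₁
    rw [← hL'def] at hQm
    have hY' : (0 : ℝ) < 3 * (D' : ℝ) ^ β := mul_pos (by norm_num) (Real.rpow_pos_of_pos hx' _)
    have h1 := L'.log_length_intF_le (MP := Real.exp (3 * (D' : ℝ) ^ β)) (MQ := Real.exp (3 * (D' : ℝ) ^ β))
      (Real.one_le_exp hY'.le) (Real.one_le_exp hY'.le) hPm.2.1 hQm.2.1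
    obtain ⟨N', hN'⟩ : ∃ N' : ℕ, N' = Fintype.card (PhiRow D') := ⟨_, rfl⟩
    obtain ⟨N₀', hN₀'⟩ : ∃ N₀' : ℕ, N₀' = Fintype.card ↥(finsuppAntidiag (univ : Finset (Fin 3)) (2 * D')) := ⟨_, rfl⟩
    obtain ⟨N₁', hN₁'⟩ : ∃ N₁' : ℕ, N₁' = Fintype.card ↥L'.M₁ := ⟨_, rfl⟩
    rw [← hN', ← hN₀', ← hN₁', Real.log_exp] at h1
    have hNeq' : (N' : ℝ) = ((3 * D' + 2).choose 2 : ℝ) := by rw [hN', LevelPkg.card_phiRow]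
    have h5' : 2 ≤ D' := le_trans (by norm_num) (h5le D' hD'₁)
    have hN₀r' : (N₀' : ℝ) ≤ 5 * (D' : ℝ) ^ 2 := by
      rw [hN₀', LevelPkg.card_antidiag_two]; exact choose_two_le h5'
    have hN₁r' : (N₁' : ℝ) ≤ 5 * (D' : ℝ) ^ 2 := by
      have : N₁' ≤ (2 * D' + 2).choose 2 := by rw [hN₁']; exact L'.card_M₁_le
      exact le_trans (by exact_mod_cast this) (choose_two_le h5')
    have hf := LevelPkg.log_factorial_le N'
    have hNN := hE'.1.1.1.1.2
    have hp2b' : (D' : ℝ) ^ (2 + β) = (D' : ℝ) ^ 2 * (D' : ℝ) ^ β := by rw [Real.rpow_add hx', Real.rpow_two]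
    rw [hp2b', ← hNeq'] at hNN
    rw [hp2b']
    have hβ' : 0 ≤ (D' : ℝ) ^ β := Real.rpow_nonneg hx'.le _
    have h3β : (0 : ℝ) ≤ 3 * (D' : ℝ) ^ β := mul_nonneg (by norm_num) hβ'
    have e1 := mul_le_mul_of_nonneg_right hN₀r' h3β
    have e2 := mul_le_mul_of_nonneg_right hN₁r' h3β
    linarith only [h1, hf, hNN, e1, e2]
  have hhOle : hO ≤ A₃ * (Ds : ℝ) ^ (1 + β - τ) := by
    -- `T' D' Σ h ≤ n · 37 D'^{2+β}` hence `hO ≤ 37 D'^{2+β}/(T' D') ≤ 74 D'^{1+β-τ} ≤ A₃ Ds^{1+β-τ}`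
    have h1 : (Tn D' : ℝ) * (D' * (hO * Module.finrank ℚ (closureField S))) ≤
        Module.finrank ℚ (closureField S) * (37 * (D' : ℝ) ^ (2 + β)) := by
      have : hO * Module.finrank ℚ (closureField S) = ∑ j ∈ O, logHeight ((L.cfg (closureField S) hK).rep j) := by
        rw [hhO]; field_simp
      rw [this]
      exact hht3.trans (mul_le_mul_of_nonneg_left hlogL' hn0.le)
    have h2 : (Tn D' : ℝ) * D' * hO ≤ 37 * (D' : ℝ) ^ (2 + β) := by
      have h1' : ((Tn D' : ℝ) * D' * hO) * Module.finrank ℚ (closureField S) ≤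
          (37 * (D' : ℝ) ^ (2 + β)) * Module.finrank ℚ (closureField S) := by linarith only [h1]
      exact le_of_mul_le_mul_right h1' hn0
    -- divide: `hO ≤ 37 D'^{2+β} / (T' D')` with `T' ≥ D'^τ/2`
    have h3 : hO * ((D' : ℝ) ^ τ * D') ≤ 74 * (D' : ℝ) ^ (2 + β) := by
      have e := mul_le_mul_of_nonneg_left hT'ge (mul_nonneg hhO0 hx'.le)
      linarith only [e, h2]
    have h4 : (D' : ℝ) ^ (2 + β) = (D' : ℝ) ^ (1 + β - τ) * ((D' : ℝ) ^ τ * D') := by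
      have e : (2 : ℝ) + β = (1 + β - τ) + τ + 1 := by ring
      rw [e, Real.rpow_add hx', Real.rpow_add hx', Real.rpow_one]; ring
    rw [h4] at h3
    have hpos : 0 < (D' : ℝ) ^ τ * D' := mul_pos (Real.rpow_pos_of_pos hx' _) hx'
    have h5 : hO ≤ 74 * (D' : ℝ) ^ (1 + β - τ) := by
      exact le_of_mul_le_mul_right (by linarith only [h3]) hpos
    have h6 : (D' : ℝ) ^ (1 + β - τ) ≤ (2 * Ds : ℝ) ^ (1 + β - τ) :=
      Real.rpow_le_rpow hx'.le hD'2 (by linarith only [hτβ])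
    rw [Real.mul_rpow (by norm_num) hxs.le] at h6
    have e := mul_le_mul_of_nonneg_left h6 (by norm_num : (0 : ℝ) ≤ 74)
    rw [hA₃]; linarith only [h5, e]
  have hdle : d ≤ 8 * (Ds : ℝ) ^ (2 - τ) := by
    have h1 : (Tn D' : ℝ) * d ≤ (D' : ℝ) ^ 2 := by rw [hd]; exact_mod_cast hdeg3
    have h2 : d * ((D' : ℝ) ^ τ) ≤ 2 * (D' : ℝ) ^ 2 := by
      have e := mul_le_mul_of_nonneg_left hT'ge (by linarith only [hd1] : (0 : ℝ) ≤ d)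
      linarith only [e, h1]
    have h3 : (D' : ℝ) ^ (2 : ℕ) = (D' : ℝ) ^ (2 - τ) * (D' : ℝ) ^ τ := by
      rw [← Real.rpow_add hx', ← Real.rpow_two]; congr 1; ring
    rw [h3] at h2
    have hpos : 0 < (D' : ℝ) ^ τ := Real.rpow_pos_of_pos hx' _
    have h4 : d ≤ 2 * (D' : ℝ) ^ (2 - τ) := le_of_mul_le_mul_right (by linarith only [h2]) hpos
    have h5 : (D' : ℝ) ^ (2 - τ) ≤ (2 * Ds : ℝ) ^ (2 - τ) := Real.rpow_le_rpow hx'.le hD'2 (by linarith only [hτ2])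
    rw [Real.mul_rpow (by norm_num) hxs.le] at h5
    have h6 : (2 : ℝ) ^ (2 - τ) ≤ 4 := by
      calc (2 : ℝ) ^ (2 - τ) ≤ (2 : ℝ) ^ (2 : ℝ) := Real.rpow_le_rpow_of_exponent_le (by norm_num) (by linarith only [hτ0])
        _ = 4 := by norm_num
    have e := mul_le_mul_of_nonneg_right h6 (Real.rpow_nonneg hxs.le (2 - τ))
    linarith only [h4, h5, e]
  /- ───── Steps 4–5 ───── -/
  have hEs := hD₁ Ds hDs₁
  have hbig : Real.log 2 + 2 * roy_c2 ξ η ^ 2 - (Ds : ℝ) ^ ν / 4 <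
      -(Ds * ((∑ j ∈ (L.cfg (closureField S) hK).orb j₀, logHeight ((L.cfg (closureField S) hK).rep j)) /
          Module.finrank ℚ (closureField S)) +
        ((L.cfg (closureField S) hK).orb j₀).card * (Ds * Real.log 3 + 3 * (Ds : ℝ) ^ β)) := by
    rw [← hOdef, ← hhO, ← hd]
    have h4 := hEs.1.1.2
    have hlog3 : 0 ≤ (Ds : ℝ) * Real.log 3 + 3 * (Ds : ℝ) ^ β :=
      add_nonneg (mul_nonneg hxs.le (Real.log_nonneg (by norm_num))) (mul_nonneg (by norm_num) (Real.rpow_nonneg hxs.le _))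
    have h1 : (Ds : ℝ) * hO ≤ (Ds : ℝ) * (A₃ * (Ds : ℝ) ^ (1 + β - τ)) := mul_le_mul_of_nonneg_left hhOle hxs.le
    have h2 : d * ((Ds : ℝ) * Real.log 3 + 3 * (Ds : ℝ) ^ β) ≤ 8 * (Ds : ℝ) ^ (2 - τ) * ((Ds : ℝ) * Real.log 3 + 3 * (Ds : ℝ) ^ β) :=
      mul_le_mul_of_nonneg_right hdle hlog3
    linarith only [h4, h1, h2]
  have hstep45 := (L.cfg (closureField S) hK).step45_combined j₀ (T := T) hRh hRmem hRne
    (hT1 Ds hDs₁) (add_nonneg (mul_nonneg hxs.le (Real.log_nonneg (by norm_num))) (mul_nonneg (by norm_num) (Real.rpow_nonneg hxs.le _)))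
    (fun j _ => hd₁pos j) hbig (by rw [← hOdef]; exact hdist2)
  rw [← hOdef, ← hhO, ← hd] at hstep45
  -- simplify the right-hand side with the Step-4 constant threshold
  have hc := hEs.1.2
  have hR8 : (Ds : ℝ) * hO + d * (Ds * Real.log 3 + 3 * (Ds : ℝ) ^ β) +
      d * Real.log (4 * (3 ^ Ds * Real.exp (3 * (Ds : ℝ) ^ β) * roy_c4 ξ η ^ Ds)) ≤
        8 * (Ds : ℝ) ^ β * d + Ds * hO := by
    have hlog : Real.log (4 * (3 ^ Ds * Real.exp (3 * (Ds : ℝ) ^ β) * roy_c4 ξ η ^ Ds)) =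
        Real.log 4 + Ds * Real.log 3 + 3 * (Ds : ℝ) ^ β + Ds * Real.log (roy_c4 ξ η) := by
      have p3 : (0 : ℝ) < 3 ^ Ds := pow_pos (by norm_num) _
      have pe : (0 : ℝ) < Real.exp (3 * (Ds : ℝ) ^ β) := Real.exp_pos _
      have pc : (0 : ℝ) < roy_c4 ξ η ^ Ds := pow_pos hc4 _
      rw [Real.log_mul (by norm_num) (mul_pos (mul_pos p3 pe) pc).ne', Real.log_mul (mul_pos p3 pe).ne' pc.ne',
        Real.log_mul p3.ne' pe.ne', Real.log_pow, Real.log_exp, Real.log_pow]; ring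
    rw [hlog]
    have e := mul_le_mul_of_nonneg_left hc (by linarith only [hd1] : (0 : ℝ) ≤ d)
    linarith only [e]
  have hratio : 0 ≤ (T : ℝ) / Tn Ds + 1 :=
    add_nonneg (div_nonneg (Nat.cast_nonneg _) (Nat.cast_nonneg _)) zero_le_one
  have hineq : κ * (D : ℝ) ^ δ * ((D : ℝ) ^ β * d + D * hO) ≤
      ((T : ℝ) / Tn Ds + 1) * (8 * (Ds : ℝ) ^ β * d + Ds * hO) := by
    rw [← hΛ₂]; exact hstep45.trans (mul_le_mul_of_nonneg_left hR8 hratio)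
  refine ⟨D, hDN, Ds, d, hO, T, Tn Ds, hxs1, by exact_mod_cast (by omega : Ds ≤ D), hd1, hhO0, hhOle,
    Nat.cast_nonneg T, hTτ, by exact_mod_cast hT1 Ds hDs₁, hT2 Ds hDs₁, hineq⟩

end Roy2013

/-- **Roy 2013, Theorem 1.1** — the discharge of the named fact `roy2013_thm_1_1` under the fact's
own fully qualified name `Literature.NumberTheory.Transcendental.roy2013_thm_1_1_holds` (the proof is
`Roy2013.roy2013_thm_1_1_holds` above). [cite: Roy2013, Theorem 1.1 and §7] -/
theorem roy2013_thm_1_1_holds : roy2013_thm_1_1 := Roy2013.roy2013_thm_1_1_holds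

end Literature.NumberTheory.Transcendental
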